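import Literature.NumberTheory.Sieve.NumberFieldTypeTwoLS
import Literature.NumberTheory.Sieve.TypeTwoReparam
import Literature.NumberTheory.Sieve.TypeTwoCoefficients
import Literature.NumberTheory.Sieve.SmoothIdealCosetSums
import HarnessLib

/-!
# The type II bound for one block (Hinz 1988, §4 (4.20), smooth form)

Topic `Literature/NumberTheory/Sieve`, sub-namespace `TypeTwoBlock`. For one block of the type II
sum (ideals `𝔟` of norm in `(M'/2, M']` in one narrow class, auxiliary primes `𝔭₁, 𝔭₂`, a
balanced totally positive generator `ρ₀` of `𝔭₁𝔭₂` and balanced totally positive generators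
`gen 𝔟` of `𝔭₁𝔟`, Hinz (4.11)–(4.19)), this file combines

* the reparametrisation identity `TypeTwoReparam.norm_S4block_eq`,
* the smooth bilinear large sieve `TypeTwoLS.typeTwoLS` with `𝔞₁ = 𝔭₁`, `𝔞₂ = 𝔭₂`
  (cube sides `X₁ = C_b(N𝔭₁M')^{1/d}`, `X₂ = C_b^d (2N𝔭₂/M')^{1/d} M`, so that
  `X₁^d/N𝔭₁ = C_b^d M'` and `X₂^d/N𝔭₂ = 2C_b^{d²}M^d/M'` do NOT depend on `N𝔭ᵢ`),
* the coefficient bounds of `TypeTwoCoefficients` (`∑|c₁|² ≤ (log M')² #Bl`,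
  `∑|c₂|² ≤ C (1 + log(2C_b^{d²}M^d))^{d-1} (2C_b^{d²}M^d/M') H(U)³`),

into **Hinz's (4.20) for the block**:

  `∑_{N𝔮≤P,(𝔮,𝔭₁𝔭₂)=1} (N𝔮/φ(𝔮)) ∑*_χ |S₄-block(χ)|`
  `  ≤ C ‖k̂‖₁^d √((P² + C_b^dM') (log M')² #Bl) √((P² + 2C_b^{d²}M^d/M') (1+log(2C_b^{d²}M^d))^{d-1} (2C_b^{d²}M^d/M') H(U)³)`

(`block_bound`). Also proved here: the cube `cubeF M` as a `Finset` and the support of the weight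
(`mem_cubeF_of_weightΩ_ne_zero`), the lower bound for the conjugates of a balanced element
(`rpow_le_remb_of_balanced`), the size of `α₂ = ρ₀α/gen 𝔟` (`quot_mem_A₂`), and the fine count
of generators of a fixed ideal in a cube (`card_generators_box₀_le_fine`).

## References

* J. Hinz, Acta Arith. 51 (1988), §4, (4.11)–(4.20), p. 188. [cite: Hinz1988, §4 (4.20)]
-/

noncomputable section

open Finset NumberField NumberField.InfinitePlace MeasureTheory
  Literature.NumberTheory.Sieve.NumberFieldLS Literature.NumberTheory.Sieve.BoxPrimes
  Literature.NumberTheory.Sieve.NumberFieldVaughan Literature.NumberTheory.Sieve.LogSep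
  Literature.NumberTheory.Sieve.MitsuiPNT Literature.NumberTheory.LFunctions
  Literature.NumberTheory.LFunctions.NumberField Literature.NumberTheory.Sieve.CastilloEtAl2015
  Literature.NumberTheory.Sieve.TypeTwoReparam Literature.NumberTheory.Sieve.TypeTwoCoeff
  Literature.NumberTheory.Sieve.TypeTwoLS Literature.NumberTheory.Sieve.PrimRed
  Literature.NumberTheory.LFunctions.HeckeCone Literature.Algebra.EuclideanLattices.MitsuiSum
open scoped Classical FourierTransform

namespace Literature.NumberTheory.Sieve.TypeTwoBlock

variable {K : Type*} [Field K] [NumberField K] [IsTotallyReal K]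

local notation "d" => Module.finrank ℚ K
local notation "RP" => {w : InfinitePlace K // IsReal w}
local notation "rk" => Module.finrank ℝ (NumberField.Units.dirichletUnitTheorem.logSpace K)

/-! ## The cube as a `Finset` and the support of the weight -/

variable (K) in
/-- `A₀(X)` as a `Finset`. [folklore] -/
def cubeF (X : ℝ) : Finset (𝓞 K) := (finite_box₀ (K := K) X).toFinset

omit [IsTotallyReal K] in
/-- Membership in `cubeF`. [folklore] -/
theorem mem_cubeF {X : ℝ} {α : 𝓞 K} : α ∈ cubeF K X ↔ α ∈ box₀ K X := by
  rw [cubeF, Set.Finite.mem_toFinset]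

omit [NumberField K] in
/-- `α ∈ A₀(X)` iff `0 < σ_w α ≤ X` for all real places (totally real `K`). [folklore] -/
theorem mem_box₀_iff_remb {X : ℝ} {α : 𝓞 K} :
    α ∈ box₀ K X ↔ ∀ w : RP, 0 < remb K (α : K) w ∧ remb K (α : K) w ≤ X := by
  rw [box₀, Set.mem_setOf_eq]
  haveI : IsEmpty {w : InfinitePlace K // IsComplex w} := SmoothCoset.isEmpty_complexPlaces K
  simp only [IsEmpty.forall_iff, and_true, Set.mem_Ioc]
  rfl

omit [IsTotallyReal K] in
/-- Cube points are totally positive. [folklore] -/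
theorem isTotPos_of_mem_cubeF {X : ℝ} {α : 𝓞 K} (h : α ∈ cubeF K X) : NumberField.IsTotPos K (α : K) :=
  isTotPos_of_mem_box₀ (mem_cubeF.1 h)

/-- Conjugates of cube points are `≤ X`. [folklore] -/
theorem remb_le_of_mem_cubeF {X : ℝ} {α : 𝓞 K} (h : α ∈ cubeF K X) (w : RP) : remb K (α : K) w ≤ X :=
  ((mem_box₀_iff_remb.1 (mem_cubeF.1 h)) w).2

/-- **The support of the weight is the cube**: if `k = 0` on `(0, ∞)` and `α ≫ 0` has
`Ω(α) ≠ 0` then `α ∈ A₀(M)`. [folklore] -/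
theorem mem_cubeF_of_weightΩ_ne_zero {k : ℝ → ℂ} (hk : ∀ v, 0 < v → k v = 0) {M : ℝ} (hM : 0 < M)
    {α : 𝓞 K} (hα : NumberField.IsTotPos K (α : K)) (hne : weightΩ K k M α ≠ 0) : α ∈ cubeF K M := by
  rw [mem_cubeF, mem_box₀_iff_remb]
  intro w
  have hpos : 0 < remb K (α : K) w := remb_pos_of_isTotPos hα w
  refine ⟨hpos, ?_⟩
  by_contra hlt
  push Not at hlt
  apply hne
  refine Finset.prod_eq_zero (Finset.mem_univ w) (hk _ ?_)
  have := Real.log_lt_log hM hlt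
  linarith

/-! ## Balanced elements: lower bounds for the conjugates -/

/-- **Balanced elements are balanced from below**: if `x ≫ 0` and `σ_w x ≤ C N^{1/d}` for all `w`
(`N = N((x))`, `C ≥ 1`), then `N^{1/d} ≤ C^{d-1} σ_w x` for every `w`. [cite: Hinz1988, §4 (4.14)] -/
theorem rpow_le_remb_of_balanced {x : 𝓞 K} (hx : NumberField.IsTotPos K (x : K)) {C : ℝ}
    (hup : ∀ w : RP, remb K (x : K) w ≤ C * (Ideal.absNorm (Ideal.span {x}) : ℝ) ^ ((d : ℝ)⁻¹)) (w : RP) :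
    (Ideal.absNorm (Ideal.span {x}) : ℝ) ^ ((d : ℝ)⁻¹) ≤ C ^ (d - 1) * remb K (x : K) w := by
  have hd : 0 < d := Module.finrank_pos
  set N : ℝ := (Ideal.absNorm (Ideal.span {x}) : ℝ) with hN
  set t : ℝ := N ^ ((d : ℝ)⁻¹) with ht
  have hx0 : (x : K) ≠ 0 := by
    intro h; have := hx (Classical.arbitrary RP); rw [h] at this; simp at this
  have hNpos : 0 < N := by
    rw [hN]; exact absNorm_pos_of_ne_bot (by rw [Ne, Ideal.span_singleton_eq_bot]; exact_mod_cast hx0)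
  have htpos : 0 < t := Real.rpow_pos_of_pos hNpos _
  have hprod : ∏ w' : RP, remb K (x : K) w' = N := by
    have h1 := abs_norm_eq_prod_abs_remb (K := K) (x : K)
    have h2 : (Ideal.absNorm (Ideal.span {x}) : ℝ) = |(Algebra.norm ℚ (x : K) : ℝ)| := by
      rw [Ideal.absNorm_span_singleton, ← Algebra.coe_norm_int x, Rat.cast_intCast, Nat.cast_natAbs, Int.cast_abs]
    rw [hN, h2, h1]
    exact Finset.prod_congr rfl fun w' _ => (abs_of_pos (remb_pos_of_isTotPos hx w')).symm
  have htd : t ^ d = N := by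
    rw [ht, ← Real.rpow_natCast, ← Real.rpow_mul hNpos.le, inv_mul_cancel₀ (by exact_mod_cast hd.ne'), Real.rpow_one]
  -- `N = σ_w x · ∏_{w' ≠ w} σ_{w'} x ≤ σ_w x · (C t)^{d-1}`
  have hsplit : N = remb K (x : K) w * ∏ w' ∈ (Finset.univ : Finset RP).erase w, remb K (x : K) w' := by
    rw [← hprod, Finset.mul_prod_erase _ _ (Finset.mem_univ w)]
  have hrest : ∏ w' ∈ (Finset.univ : Finset RP).erase w, remb K (x : K) w' ≤ (C * t) ^ (d - 1) := by
    calc ∏ w' ∈ (Finset.univ : Finset RP).erase w, remb K (x : K) w'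
        ≤ ∏ _w' ∈ (Finset.univ : Finset RP).erase w, (C * t) :=
          Finset.prod_le_prod (fun w' _ => (remb_pos_of_isTotPos hx w').le) fun w' _ => hup w'
      _ = (C * t) ^ (d - 1) := by
          rw [Finset.prod_const, Finset.card_erase_of_mem (Finset.mem_univ w), Finset.card_univ,
            SmoothCoset.card_RP_eq]
  have hle : t ^ d ≤ remb K (x : K) w * (C * t) ^ (d - 1) := by
    rw [htd, hsplit]
    exact mul_le_mul_of_nonneg_left hrest (remb_pos_of_isTotPos hx w).le
  -- divide by `t^{d-1}`
  obtain ⟨m, hm⟩ : ∃ m, d = m + 1 := ⟨d - 1, by omega⟩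
  rw [hm, Nat.add_sub_cancel, pow_succ, mul_pow] at hle
  rw [hm, Nat.add_sub_cancel]
  have htm : 0 < t ^ m := pow_pos htpos m
  have : t ^ m * t ≤ t ^ m * (C ^ m * remb K (x : K) w) := by nlinarith
  exact le_of_mul_le_mul_left this htm

/-! ## The element `α₂ = ρ₀ α / gen 𝔟` lies in the cube of side `X₂` -/

/-- **Size of `α₂`** (Hinz (4.16)): with balanced `ρ₀` (`σ_wρ₀ ≤ C_b N(𝔭₁𝔭₂)^{1/d}`) and balanced
`gen 𝔟` (`σ_w gen 𝔟 ≤ C_b N(𝔭₁𝔟)^{1/d}`), `N𝔟 ≥ M'/2`, `α ∈ A₀(M)`, `𝔟 ∣ (α)`: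
`α₂ = ρ₀α/gen 𝔟` is totally positive, lies in `𝔭₂`, and `σ_w α₂ ≤ C_b^d (2N𝔭₂/M')^{1/d} M`.
[cite: Hinz1988, §4 (4.16)] -/
theorem quot_mem_A₂ {𝔭₁ 𝔭₂ 𝔟 : Ideal (𝓞 K)} {ρ₀ g α : 𝓞 K} (h𝔭₁ : 𝔭₁ ≠ ⊥) (h𝔭₂ : 𝔭₂ ≠ ⊥) (h𝔟 : 𝔟 ≠ ⊥)
    (hρ : Ideal.span {ρ₀} = 𝔭₁ * 𝔭₂) (hρpos : NumberField.IsTotPos K (ρ₀ : K))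
    (hg : Ideal.span {g} = 𝔭₁ * 𝔟) (hgpos : NumberField.IsTotPos K (g : K))
    {Cb : ℝ} (hCb : 1 ≤ Cb)
    (hρbal : ∀ w : RP, remb K (ρ₀ : K) w ≤ Cb * (Ideal.absNorm (Ideal.span {ρ₀}) : ℝ) ^ ((d : ℝ)⁻¹))
    (hgbal : ∀ w : RP, remb K (g : K) w ≤ Cb * (Ideal.absNorm (Ideal.span {g}) : ℝ) ^ ((d : ℝ)⁻¹))
    {M M' : ℝ} (hM : 0 < M) (hM' : 0 < M') (hN𝔟 : M' / 2 ≤ Ideal.absNorm 𝔟)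
    (hα : α ∈ cubeF K M) (hdvd : 𝔟 ∣ Ideal.span {α}) :
    NumberField.IsTotPos K (quot ρ₀ g α : K) ∧ quot ρ₀ g α ∈ 𝔭₂ ∧
      ∀ w : RP, remb K (quot ρ₀ g α : K) w ≤
        Cb ^ d * (2 * Ideal.absNorm 𝔭₂ / M') ^ ((d : ℝ)⁻¹) * M := by
  have hd : 0 < d := Module.finrank_pos
  have hdinv : 0 < (d : ℝ)⁻¹ := by positivity
  have hαpos := isTotPos_of_mem_cubeF hα
  have hgd : g ∣ ρ₀ * α := gen_dvd hρ hg hdvd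
  have hmul : g * quot ρ₀ g α = ρ₀ * α := gen_mul_quot hgd
  have hmulK : (g : K) * (quot ρ₀ g α : K) = (ρ₀ : K) * (α : K) := by
    exact_mod_cast congrArg (fun x : 𝓞 K => (x : K)) hmul
  have hqpos : NumberField.IsTotPos K (quot ρ₀ g α : K) := by
    refine isTotPos_of_mul_left (x := (g : K)) ?_ hgpos
    rw [hmulK]; exact hρpos.mul hαpos
  -- the ideal of `α₂`
  have hspan : Ideal.span {quot ρ₀ g α} = 𝔭₂ * cofactor (Ideal.span {α}) 𝔟 := by
    have e1 : Ideal.span {g} * Ideal.span {quot ρ₀ g α} = Ideal.span {ρ₀} * Ideal.span {α} := by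
      rw [Ideal.span_singleton_mul_span_singleton, Ideal.span_singleton_mul_span_singleton, hmul]
    rw [hg, hρ, ← mul_cofactor hdvd] at e1
    have e2 : 𝔭₁ * 𝔟 * Ideal.span {quot ρ₀ g α} = 𝔭₁ * 𝔟 * (𝔭₂ * cofactor (Ideal.span {α}) 𝔟) := by
      rw [e1]; ring
    exact mul_left_cancel₀ (mul_ne_zero h𝔭₁ h𝔟) e2
  have hmem : quot ρ₀ g α ∈ 𝔭₂ := by
    have : Ideal.span {quot ρ₀ g α} ≤ 𝔭₂ := by rw [hspan]; exact Ideal.mul_le_right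
    exact (Ideal.span_singleton_le_iff_mem _).1 this
  refine ⟨hqpos, hmem, fun w => ?_⟩
  -- norms
  have hN𝔭₁ := absNorm_pos_of_ne_bot h𝔭₁
  have hN𝔭₂ := absNorm_pos_of_ne_bot h𝔭₂
  have hN𝔟pos := absNorm_pos_of_ne_bot h𝔟
  have hNρ : (Ideal.absNorm (Ideal.span {ρ₀}) : ℝ) = Ideal.absNorm 𝔭₁ * Ideal.absNorm 𝔭₂ := by
    rw [hρ, map_mul, Nat.cast_mul]
  have hNg : (Ideal.absNorm (Ideal.span {g}) : ℝ) = Ideal.absNorm 𝔭₁ * Ideal.absNorm 𝔟 := by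
    rw [hg, map_mul, Nat.cast_mul]
  -- the three conjugates
  have hgw : 0 < remb K (g : K) w := remb_pos_of_isTotPos hgpos w
  have hρw := remb_pos_of_isTotPos hρpos w
  have hαw := remb_pos_of_isTotPos hαpos w
  have hqw : remb K (quot ρ₀ g α : K) w = remb K (ρ₀ : K) w * remb K (α : K) w / remb K (g : K) w := by
    have h1 : remb K (g : K) w * remb K (quot ρ₀ g α : K) w = remb K (ρ₀ : K) w * remb K (α : K) w := by
      have := congrArg (fun x : K => remb K x w) hmulK
      simpa [remb_mul] using this
    field_simp
    linarith
  -- lower bound for `σ_w g`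
  have hglow := rpow_le_remb_of_balanced hgpos hgbal w
  rw [hNg] at hglow
  -- upper bounds
  have hρup : remb K (ρ₀ : K) w ≤ Cb * (Ideal.absNorm 𝔭₁ * Ideal.absNorm 𝔭₂ : ℝ) ^ ((d : ℝ)⁻¹) := by
    have := hρbal w; rwa [hNρ] at this
  have hαup : remb K (α : K) w ≤ M := remb_le_of_mem_cubeF hα w
  -- `(N𝔭₁N𝔟)^{1/d} ≥ ...`: rewrite the rpow quotients
  have hsplit₁ : (Ideal.absNorm 𝔭₁ * Ideal.absNorm 𝔭₂ : ℝ) ^ ((d : ℝ)⁻¹) =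
      (Ideal.absNorm 𝔭₁ : ℝ) ^ ((d : ℝ)⁻¹) * (Ideal.absNorm 𝔭₂ : ℝ) ^ ((d : ℝ)⁻¹) :=
    Real.mul_rpow hN𝔭₁.le hN𝔭₂.le
  have hsplit₂ : (Ideal.absNorm 𝔭₁ * Ideal.absNorm 𝔟 : ℝ) ^ ((d : ℝ)⁻¹) =
      (Ideal.absNorm 𝔭₁ : ℝ) ^ ((d : ℝ)⁻¹) * (Ideal.absNorm 𝔟 : ℝ) ^ ((d : ℝ)⁻¹) :=
    Real.mul_rpow hN𝔭₁.le hN𝔟pos.le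
  set a₁ := (Ideal.absNorm 𝔭₁ : ℝ) ^ ((d : ℝ)⁻¹) with ha₁
  set a₂ := (Ideal.absNorm 𝔭₂ : ℝ) ^ ((d : ℝ)⁻¹) with ha₂
  set b := (Ideal.absNorm 𝔟 : ℝ) ^ ((d : ℝ)⁻¹) with hb
  have ha₁pos : 0 < a₁ := Real.rpow_pos_of_pos hN𝔭₁ _
  have ha₂pos : 0 < a₂ := Real.rpow_pos_of_pos hN𝔭₂ _
  have hbpos : 0 < b := Real.rpow_pos_of_pos hN𝔟pos _
  rw [hsplit₁] at hρup
  rw [hsplit₂] at hglow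
  -- `b ≥ (M'/2)^{1/d}`, i.e. `b⁻¹ ≤ (2/M')^{1/d}`
  have hbinv : b⁻¹ ≤ (2 / M') ^ ((d : ℝ)⁻¹) := by
    rw [hb, ← Real.inv_rpow hN𝔟pos.le]
    refine Real.rpow_le_rpow (by positivity) ?_ hdinv.le
    rw [inv_le_comm₀ hN𝔟pos (by positivity), inv_div]
    exact hN𝔟
  have hCpos : 0 < Cb := by linarith
  -- main estimate
  have hkey : remb K (ρ₀ : K) w * remb K (α : K) w / remb K (g : K) w ≤
      Cb ^ d * (a₂ * b⁻¹) * M := by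
    rw [div_le_iff₀ hgw]
    have hg' : a₁ * b ≤ Cb ^ (d - 1) * remb K (g : K) w := hglow
    calc remb K (ρ₀ : K) w * remb K (α : K) w ≤ (Cb * (a₁ * a₂)) * M :=
          mul_le_mul hρup hαup hαw.le (by positivity)
      _ = Cb * a₂ * M * b⁻¹ * (a₁ * b) := by field_simp
      _ ≤ Cb * a₂ * M * b⁻¹ * (Cb ^ (d - 1) * remb K (g : K) w) :=
          mul_le_mul_of_nonneg_left hg' (by positivity)
      _ = Cb ^ d * (a₂ * b⁻¹) * M * remb K (g : K) w := by
          obtain ⟨m, hm⟩ : ∃ m, d = m + 1 := ⟨d - 1, by omega⟩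
          rw [hm, Nat.add_sub_cancel, pow_succ]; ring
  rw [hqw]
  refine hkey.trans ?_
  have h2 : a₂ * b⁻¹ ≤ (2 * Ideal.absNorm 𝔭₂ / M') ^ ((d : ℝ)⁻¹) := by
    calc a₂ * b⁻¹ ≤ a₂ * (2 / M') ^ ((d : ℝ)⁻¹) := mul_le_mul_of_nonneg_left hbinv ha₂pos.le
      _ = (2 * Ideal.absNorm 𝔭₂ / M') ^ ((d : ℝ)⁻¹) := by
          rw [ha₂, ← Real.mul_rpow hN𝔭₂.le (by positivity)]
          congr 1; ring
  gcongr

/-! ## Generators of a fixed ideal in the cube: the fine count -/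

/-- **Fine count of generators in the cube**: for `X > 0` and an ideal `I` there are at most
`C (1 + log(X^d/N I)/d)^{d-1}` generators of `I` in `A₀(X)` (none unless `I ∈ P⁺`, `N I ≤ X^d`).
[cite: Hinz1988, §4 p. 188] -/
theorem card_generators_box₀_le_fine : ∃ C : ℝ, 0 ≤ C ∧ ∀ X : ℝ, 0 < X → ∀ I : Ideal (𝓞 K),
    (Ideal.absNorm I : ℝ) ≤ X ^ d →
    (Nat.card {α : 𝓞 K // α ∈ box₀ K X ∧ Ideal.span {α} = I} : ℝ) ≤
      C * (1 + Real.log (X ^ d / Ideal.absNorm I) / d) ^ rk := by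
  obtain ⟨R₀, hR₀⟩ := (isBounded_logBox (K := K)).subset_closedBall 0
  set R : ℝ := max R₀ 0 with hRdef
  have hR : logBox K ⊆ Metric.closedBall 0 R := hR₀.trans (Metric.closedBall_subset_closedBall (le_max_left _ _))
  obtain ⟨C, hC0, hC⟩ := exists_shapeFun_le (L := posUnitLattice K) MeasureTheory.volume hR (le_max_right _ _)
  have hd : (0 : ℝ) < d := by exact_mod_cast Module.finrank_pos (R := ℚ) (M := K)
  refine ⟨C, hC0, fun X hX I hIX => ?_⟩
  have hfin : ({α : 𝓞 K | α ∈ box₀ K X ∧ Ideal.span {α} = I} : Set (𝓞 K)).Finite :=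
    (finite_box₀ _).subset fun α h => h.1
  rcases Set.eq_empty_or_nonempty {α : 𝓞 K | α ∈ box₀ K X ∧ Ideal.span {α} = I} with hempty | ⟨α₀, hα₀⟩
  · have : Nat.card {α : 𝓞 K // α ∈ box₀ K X ∧ Ideal.span {α} = I} = 0 := by
      have hc : Nat.card {α : 𝓞 K // α ∈ box₀ K X ∧ Ideal.span {α} = I} = hfin.toFinset.card :=
        Nat.card_eq_card_finite_toFinset hfin
      rw [hc, Finset.card_eq_zero, ← Finset.coe_eq_empty, Set.Finite.coe_toFinset]
      exact hempty
    rw [this, Nat.cast_zero]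
    refine mul_nonneg hC0 (pow_nonneg ?_ _)
    have h1 : (1 : ℝ) ≤ Ideal.absNorm I ∨ Ideal.absNorm I = 0 := by
      rcases Nat.eq_zero_or_pos (Ideal.absNorm I) with h | h
      · exact Or.inr (by exact_mod_cast h)
      · exact Or.inl (by exact_mod_cast h)
    rcases h1 with h1 | h1
    · have : 0 ≤ Real.log (X ^ d / Ideal.absNorm I) / d :=
        div_nonneg (Real.log_nonneg (by rwa [le_div_iff₀ (by positivity), one_mul])) hd.le
      linarith
    · rw [h1, Nat.cast_zero, div_zero, Real.log_zero, zero_div, add_zero]; exact zero_le_one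
  · obtain ⟨hP, h1, h2⟩ := span_mem_idealFamily (K := K) hα₀.1
    rw [hα₀.2] at hP h1 h2
    rw [card_fiber hX hP h2]
    have hm1 : (1 : ℝ) ≤ Ideal.absNorm I := by exact_mod_cast h1
    have hs0 : 0 ≤ Real.log (X ^ d / Ideal.absNorm I) / d := by
      refine div_nonneg (Real.log_nonneg ?_) hd.le
      rwa [le_div_iff₀ (by linarith), one_mul]
    exact hC _ hs0 (logPt K I)

/-! ## The coefficient bounds -/

omit [IsTotallyReal K] in
/-- **`∑_{α₁} |c₁(α₁)|² ≤ (log M')² #Bl`** for a block of ideals of norm `≤ M'` with an injective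
generator choice `(gen 𝔟) = 𝔭₁𝔟`. [cite: Hinz1988, §4 p. 188] -/
theorem sum_norm_coeff₁_sq_le {𝔭₁ : Ideal (𝓞 K)} (h𝔭₁ : 𝔭₁ ≠ ⊥) (Bl : Finset (Ideal (𝓞 K)))
    (gen : Ideal (𝓞 K) → 𝓞 K) (hgen : ∀ 𝔟 ∈ Bl, Ideal.span {gen 𝔟} = 𝔭₁ * 𝔟)
    {M' : ℝ} (hN : ∀ 𝔟 ∈ Bl, (Ideal.absNorm 𝔟 : ℝ) ≤ M') (h0 : ∀ 𝔟 ∈ Bl, 𝔟 ≠ ⊥) :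
    ∑ α₁ ∈ Bl.image gen, ‖coeff₁ K 𝔭₁ α₁‖ ^ 2 ≤ Real.log M' ^ 2 * Bl.card := by
  have hinj : Set.InjOn gen Bl := by
    intro 𝔟 h𝔟 𝔟' h𝔟' h
    have e := hgen 𝔟 h𝔟
    rw [h, hgen 𝔟' h𝔟'] at e
    exact (mul_left_cancel₀ h𝔭₁ e).symm
  rw [Finset.sum_image hinj]
  have hterm : ∀ 𝔟 ∈ Bl, ‖coeff₁ K 𝔭₁ (gen 𝔟)‖ ^ 2 ≤ Real.log M' ^ 2 := by
    intro 𝔟 h𝔟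
    rw [coeff₁, cofactor_eq_of_mul_eq h𝔭₁ (hgen 𝔟 h𝔟).symm, Complex.norm_real, Real.norm_eq_abs,
      abs_of_nonneg (idealVonMangoldt_nonneg _)]
    have hN1 : (1 : ℝ) ≤ Ideal.absNorm 𝔟 := by
      exact_mod_cast Nat.one_le_iff_ne_zero.2 (by rw [Ne, Ideal.absNorm_eq_zero_iff]; exact h0 𝔟 h𝔟)
    have h1 : idealVonMangoldt 𝔟 ≤ Real.log M' :=
      (idealVonMangoldt_le_log (h0 𝔟 h𝔟)).trans (Real.log_le_log (by positivity) (hN 𝔟 h𝔟))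
    exact pow_le_pow_left₀ (idealVonMangoldt_nonneg _) h1 2
  calc ∑ 𝔟 ∈ Bl, ‖coeff₁ K 𝔭₁ (gen 𝔟)‖ ^ 2 ≤ ∑ _𝔟 ∈ Bl, Real.log M' ^ 2 := Finset.sum_le_sum hterm
    _ = Real.log M' ^ 2 * Bl.card := by rw [Finset.sum_const, nsmul_eq_mul, mul_comm]

omit [IsTotallyReal K] in
/-- `|c₂(α₂)|² ≤ [𝔭₂ ∣ (α₂)] τ_U((α₂)/𝔭₂)²`. [cite: Hinz1988, §4 (4.17)] -/
theorem norm_coeff₂_sq_le (𝔭₂ : Ideal (𝓞 K)) (U : ℝ) (α₂ : 𝓞 K) (hα₂ : α₂ ≠ 0) :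
    ‖coeff₂ K 𝔭₂ U α₂‖ ^ 2 ≤
      if 𝔭₂ ∣ Ideal.span {α₂} then (tauLE K U (cofactor (Ideal.span {α₂}) 𝔭₂) : ℝ) ^ 2 else 0 := by
  unfold coeff₂
  split_ifs with h h'
  · rw [Complex.norm_real, Real.norm_eq_abs]
    have hne : cofactor (Ideal.span {α₂}) 𝔭₂ ≠ ⊥ :=
      cofactor_ne_bot (by rw [Ne, Ideal.span_singleton_eq_bot]; exact hα₂) h.2.1
    have := abs_eU_le_tauLE (K := K) U hne
    exact pow_le_pow_left₀ (abs_nonneg _) this 2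
  · exact absurd h.2.1 h'
  · rw [norm_zero, zero_pow two_ne_zero]; positivity
  · simp

/-- **`∑_{α₂ ∈ A₂} |c₂(α₂)|²`** over `A₂ = A₀(X₂) ∩ 𝔭₂`: at most
`C_g (1 + log(X₂^d/N𝔭₂)/d)^{d-1} · C_I (X₂^d/N𝔭₂) H(U)³`. [cite: Hinz1988, §4 p. 188] -/
theorem sum_norm_coeff₂_sq_le {Cg : ℝ} (hCg0 : 0 ≤ Cg)
    (hCg : ∀ X : ℝ, 0 < X → ∀ I : Ideal (𝓞 K), (Ideal.absNorm I : ℝ) ≤ X ^ d →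
      (Nat.card {α : 𝓞 K // α ∈ box₀ K X ∧ Ideal.span {α} = I} : ℝ) ≤
        Cg * (1 + Real.log (X ^ d / Ideal.absNorm I) / d) ^ rk)
    {CI : ℝ} (hCI0 : 0 ≤ CI) (hCI : ∀ x : ℝ, 0 ≤ x → ((idealsLE K x).card : ℝ) ≤ CI * x)
    {𝔭₂ : Ideal (𝓞 K)} (h𝔭₂ : 𝔭₂ ≠ ⊥) (U : ℝ) {X₂ : ℝ} (hX₂ : 0 < X₂)
    (hY : (Ideal.absNorm 𝔭₂ : ℝ) ≤ X₂ ^ d) :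
    ∑ α₂ ∈ (cubeF K X₂).filter (· ∈ 𝔭₂), ‖coeff₂ K 𝔭₂ U α₂‖ ^ 2 ≤
      Cg * (1 + Real.log (X₂ ^ d / Ideal.absNorm 𝔭₂) / d) ^ rk *
        (CI * (X₂ ^ d / Ideal.absNorm 𝔭₂) * (∑ 𝔡 ∈ idealsLE K U, ((Ideal.absNorm 𝔡 : ℕ) : ℝ)⁻¹) ^ 3) := by
  have hd : (0 : ℝ) < d := by exact_mod_cast Module.finrank_pos (R := ℚ) (M := K)
  have hN𝔭₂ := absNorm_pos_of_ne_bot h𝔭₂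
  set Y₂ : ℝ := X₂ ^ d / Ideal.absNorm 𝔭₂ with hY₂
  have hY₂1 : 1 ≤ Y₂ := by rwa [hY₂, le_div_iff₀ hN𝔭₂, one_mul]
  set Lg : ℝ := Cg * (1 + Real.log Y₂ / d) ^ rk with hLg
  have hlogY : 0 ≤ Real.log Y₂ / d := div_nonneg (Real.log_nonneg hY₂1) hd.le
  have hLg0 : 0 ≤ Lg := by rw [hLg]; positivity
  set A₂ := (cubeF K X₂).filter (· ∈ 𝔭₂) with hA₂
  set gI : Ideal (𝓞 K) → ℝ := fun 𝔞 =>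
    if 𝔭₂ ∣ 𝔞 then (tauLE K U (cofactor 𝔞 𝔭₂) : ℝ) ^ 2 else 0 with hgI
  have hgI0 : ∀ 𝔞, 0 ≤ gI 𝔞 := fun 𝔞 => by simp only [hgI]; split_ifs <;> positivity
  -- Step 1: termwise through the ideal
  have h1 : ∑ α₂ ∈ A₂, ‖coeff₂ K 𝔭₂ U α₂‖ ^ 2 ≤ ∑ α₂ ∈ A₂, gI (Ideal.span {α₂}) := by
    refine Finset.sum_le_sum fun α₂ hα₂ => ?_
    have hα0 : α₂ ≠ 0 := ne_zero_of_mem_box₀ (mem_cubeF.1 (Finset.mem_filter.1 hα₂).1)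
    exact norm_coeff₂_sq_le 𝔭₂ U α₂ hα0
  -- Step 2: fibrewise over the ideals `(α₂)`; each fibre has `≤ Lg` elements
  have hmaps : ∀ α₂ ∈ A₂, Ideal.span {α₂} ∈ A₂.image fun α => Ideal.span {α} :=
    fun α₂ h => Finset.mem_image_of_mem _ h
  have h2 : ∑ α₂ ∈ A₂, gI (Ideal.span {α₂}) ≤ Lg * ∑ 𝔞 ∈ A₂.image (fun α => Ideal.span {α}), gI 𝔞 := by
    rw [← Finset.sum_fiberwise_of_maps_to hmaps, Finset.mul_sum]
    refine Finset.sum_le_sum fun 𝔞 h𝔞 => ?_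
    rw [Finset.sum_congr rfl fun α hα => by rw [(Finset.mem_filter.1 hα).2], Finset.sum_const, nsmul_eq_mul]
    by_cases hdvd : 𝔭₂ ∣ 𝔞
    · -- fibre bound with the fine count
      obtain ⟨α₀, hα₀, rfl⟩ := Finset.mem_image.1 h𝔞
      have hα₀c := (Finset.mem_filter.1 hα₀).1
      obtain ⟨_, hN1, hNX⟩ := span_mem_idealFamily (K := K) (mem_cubeF.1 hα₀c)
      refine mul_le_mul_of_nonneg_right ?_ (hgI0 _)
      have hfib : (((A₂.filter fun α => Ideal.span {α} = Ideal.span {α₀}).card : ℕ) : ℝ) ≤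
          Nat.card {α : 𝓞 K // α ∈ box₀ K X₂ ∧ Ideal.span {α} = Ideal.span {α₀}} := by
        have hfin : ({α : 𝓞 K | α ∈ box₀ K X₂ ∧ Ideal.span {α} = Ideal.span {α₀}} : Set (𝓞 K)).Finite :=
          (finite_box₀ _).subset fun α h => h.1
        have hc : Nat.card {α : 𝓞 K // α ∈ box₀ K X₂ ∧ Ideal.span {α} = Ideal.span {α₀}} = hfin.toFinset.card :=
          Nat.card_eq_card_finite_toFinset hfin
        rw [hc]
        exact_mod_cast Finset.card_le_card fun α hα => by
          rw [Set.Finite.mem_toFinset]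
          rw [Finset.mem_filter] at hα
          exact ⟨mem_cubeF.1 (Finset.mem_filter.1 hα.1).1, hα.2⟩
      refine hfib.trans ((hCg X₂ hX₂ _ hNX).trans ?_)
      rw [hLg]
      have hNα : (0 : ℝ) < Ideal.absNorm (Ideal.span {α₀}) := by exact_mod_cast Nat.lt_of_lt_of_le Nat.zero_lt_one hN1
      have hq1 : 1 ≤ X₂ ^ d / Ideal.absNorm (Ideal.span {α₀}) := by rwa [le_div_iff₀ hNα, one_mul]
      have hqle : X₂ ^ d / Ideal.absNorm (Ideal.span {α₀}) ≤ X₂ ^ d / Ideal.absNorm 𝔭₂ := by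
        refine div_le_div_of_nonneg_left (by positivity) hN𝔭₂ ?_
        have hpos : 0 < Ideal.absNorm (Ideal.span {α₀}) := Nat.lt_of_lt_of_le Nat.zero_lt_one hN1
        exact_mod_cast Nat.le_of_dvd hpos (Ideal.absNorm_dvd_absNorm_of_le (Ideal.le_of_dvd hdvd))
      refine mul_le_mul_of_nonneg_left (pow_le_pow_left₀ ?_ ?_ _) hCg0
      · have : 0 ≤ Real.log (X₂ ^ d / Ideal.absNorm (Ideal.span {α₀})) / d := div_nonneg (Real.log_nonneg hq1) hd.le
        linarith
      · have := div_le_div_of_nonneg_right (Real.log_le_log (lt_of_lt_of_le one_pos hq1) hqle) hd.le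
        simp only [hY₂] at this ⊢
        linarith
    · simp only [hgI, if_neg hdvd, mul_zero]; exact le_rfl
  -- Step 3: `∑ gI` over the ideals of `A₂`: reindex the multiples of `𝔭₂` by `𝔠 = 𝔞/𝔭₂`
  have h3 : ∑ 𝔞 ∈ A₂.image (fun α => Ideal.span {α}), gI 𝔞 ≤ ∑ 𝔠 ∈ idealsLE K Y₂, (tauLE K U 𝔠 : ℝ) ^ 2 := by
    set T := (A₂.image (fun α => Ideal.span {α})).filter (fun 𝔞 => 𝔭₂ ∣ 𝔞) with hT
    have hzero : ∑ 𝔞 ∈ A₂.image (fun α => Ideal.span {α}), gI 𝔞 = ∑ 𝔞 ∈ T, (tauLE K U (cofactor 𝔞 𝔭₂) : ℝ) ^ 2 := by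
      rw [hT, Finset.sum_filter]
    rw [hzero]
    have hinj : Set.InjOn (fun 𝔞 => cofactor 𝔞 𝔭₂) T := by
      intro 𝔞 h𝔞 𝔞' h𝔞' h
      have e1 := mul_cofactor (Finset.mem_filter.1 h𝔞).2
      have e2 := mul_cofactor (Finset.mem_filter.1 h𝔞').2
      simp only at h
      rw [← e1, ← e2, h]
    have hmapsT : ∀ 𝔞 ∈ T, cofactor 𝔞 𝔭₂ ∈ idealsLE K Y₂ := by
      intro 𝔞 h𝔞
      rw [hT, Finset.mem_filter, Finset.mem_image] at h𝔞
      obtain ⟨⟨α₀, hα₀, rfl⟩, hdvd⟩ := h𝔞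
      obtain ⟨_, hN1, hNX⟩ := span_mem_idealFamily (K := K) (mem_cubeF.1 (Finset.mem_filter.1 hα₀).1)
      have hne : Ideal.span {α₀} ≠ ⊥ := by
        rw [Ne, Ideal.span_singleton_eq_bot]; exact ne_zero_of_mem_box₀ (mem_cubeF.1 (Finset.mem_filter.1 hα₀).1)
      rw [mem_idealsLE]
      refine ⟨cofactor_ne_bot hne hdvd, ?_⟩
      rw [hY₂, le_div_iff₀ hN𝔭₂]
      have := mul_cofactor hdvd
      have hmul : (Ideal.absNorm (Ideal.span {α₀}) : ℝ) = Ideal.absNorm 𝔭₂ * Ideal.absNorm (cofactor (Ideal.span {α₀}) 𝔭₂) := by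
        conv_lhs => rw [← this]
        rw [map_mul, Nat.cast_mul]
      nlinarith
    calc ∑ 𝔞 ∈ T, (tauLE K U (cofactor 𝔞 𝔭₂) : ℝ) ^ 2
        = ∑ 𝔠 ∈ T.image (fun 𝔞 => cofactor 𝔞 𝔭₂), (tauLE K U 𝔠 : ℝ) ^ 2 :=
          (Finset.sum_image (f := fun 𝔠 => (tauLE K U 𝔠 : ℝ) ^ 2) hinj).symm
      _ ≤ ∑ 𝔠 ∈ idealsLE K Y₂, (tauLE K U 𝔠 : ℝ) ^ 2 :=
          Finset.sum_le_sum_of_subset_of_nonneg (fun 𝔠 h𝔠 => by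
            obtain ⟨𝔞, h𝔞, rfl⟩ := Finset.mem_image.1 h𝔠; exact hmapsT 𝔞 h𝔞) fun _ _ _ => by positivity
  -- Step 4: `∑ τ_U²`
  have h4 := sum_tauLE_sq_le (K := K) hCI0 hCI U (le_trans zero_le_one hY₂1)
  calc ∑ α₂ ∈ A₂, ‖coeff₂ K 𝔭₂ U α₂‖ ^ 2 ≤ ∑ α₂ ∈ A₂, gI (Ideal.span {α₂}) := h1
    _ ≤ Lg * ∑ 𝔞 ∈ A₂.image (fun α => Ideal.span {α}), gI 𝔞 := h2
    _ ≤ Lg * ∑ 𝔠 ∈ idealsLE K Y₂, (tauLE K U 𝔠 : ℝ) ^ 2 := mul_le_mul_of_nonneg_left h3 hLg0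
    _ ≤ Lg * (CI * Y₂ * (∑ 𝔡 ∈ idealsLE K U, ((Ideal.absNorm 𝔡 : ℕ) : ℝ)⁻¹) ^ 3) :=
        mul_le_mul_of_nonneg_left h4 hLg0
    _ = _ := by rw [hLg]

/-! ## The block bound -/

variable (K) in
/-- `H(U) = ∑_{N𝔡 ≤ U} 1/N𝔡`. [folklore] -/
def harmU (U : ℝ) : ℝ := ∑ 𝔡 ∈ idealsLE K U, ((Ideal.absNorm 𝔡 : ℕ) : ℝ)⁻¹

omit [IsTotallyReal K] in
/-- `H(U) ≥ 0`. [folklore] -/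
theorem harmU_nonneg (U : ℝ) : 0 ≤ harmU K U := harmonic_nonneg U

omit [NumberField K] [IsTotallyReal K] in
/-- `ρ₀` is a unit modulo every `𝔮` prime to `𝔭₁𝔭₂ = (ρ₀)`. [folklore] -/
theorem isUnit_rho {𝔮 𝔭₁ 𝔭₂ : Ideal (𝓞 K)} {ρ₀ : 𝓞 K} (hρ : Ideal.span {ρ₀} = 𝔭₁ * 𝔭₂)
    (h₁ : IsCoprime 𝔮 𝔭₁) (h₂ : IsCoprime 𝔮 𝔭₂) : IsUnit (Ideal.Quotient.mk 𝔮 ρ₀) := by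
  rw [isUnit_mk_iff, hρ]
  have := (IsCoprime.mul_right h₁ h₂).symm
  rwa [Ideal.isCoprime_iff_sup_eq] at this

omit [IsTotallyReal K] in
/-- `(x^{1/d})^d = x`. [folklore] -/
theorem rpow_inv_pow {x : ℝ} (hx : 0 ≤ x) : (x ^ ((d : ℝ)⁻¹)) ^ d = x :=
  Real.rpow_inv_natCast_pow hx Module.finrank_pos.ne'

set_option maxHeartbeats 800000 in -- the assembly carries the large-sieve, reparametrisation and counting contexts at once
/-- **The type II bound for one block** (Hinz (4.20), smooth form; see the file docstring).
[cite: Hinz1988, §4 (4.20)] -/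
theorem block_bound : ∃ C : ℝ, 0 < C ∧
    ∀ (k : ℝ → ℂ), ContDiff ℝ 2 k → HasCompactSupport k → (∀ v, 0 < v → k v = 0) →
    ∀ (M : ℝ), 1 ≤ M → ∀ (U P : ℝ), 1 ≤ P → ∀ (Cb : ℝ), 1 ≤ Cb → ∀ (M' : ℝ), 1 ≤ M' → M' ≤ 2 * M ^ d →
    ∀ (𝔭₁ 𝔭₂ : Ideal (𝓞 K)) (ρ₀ : 𝓞 K), 𝔭₁ ≠ ⊥ → 𝔭₂ ≠ ⊥ →
      Ideal.span {ρ₀} = 𝔭₁ * 𝔭₂ → NumberField.IsTotPos K (ρ₀ : K) →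
      (∀ w : RP, remb K (ρ₀ : K) w ≤ Cb * (Ideal.absNorm (Ideal.span {ρ₀}) : ℝ) ^ ((d : ℝ)⁻¹)) →
    ∀ (Bl : Finset (Ideal (𝓞 K))) (gen : Ideal (𝓞 K) → 𝓞 K),
      (∀ 𝔟 ∈ Bl, 𝔟 ≠ ⊥ ∧ M' / 2 ≤ Ideal.absNorm 𝔟 ∧ (Ideal.absNorm 𝔟 : ℝ) ≤ M') →
      (∀ 𝔟 ∈ Bl, NumberField.IsTotPos K (gen 𝔟 : K) ∧ Ideal.span {gen 𝔟} = 𝔭₁ * 𝔟 ∧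
        ∀ w : RP, remb K (gen 𝔟 : K) w ≤ Cb * (Ideal.absNorm (Ideal.span {gen 𝔟}) : ℝ) ^ ((d : ℝ)⁻¹)) →
    ∑ 𝔮 ∈ (idealsLE K P).filter (fun 𝔮 => IsCoprime 𝔮 𝔭₁ ∧ IsCoprime 𝔮 𝔭₂),
        (Ideal.absNorm 𝔮 : ℝ) / Nat.card ((𝓞 K ⧸ 𝔮)ˣ) *
          ∑ χ ∈ primChars K 𝔮, ‖S4block K χ k M U Bl (cubeF K M)‖ ≤
      C * (∫ τ, ‖𝓕 k τ‖) ^ d *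
        (Real.sqrt ((P ^ 2 + Cb ^ d * M') * (Real.log M' ^ 2 * Bl.card)) *
          Real.sqrt ((P ^ 2 + 2 * Cb ^ (d * d) * M ^ d / M') *
            ((1 + Real.log (2 * Cb ^ (d * d) * M ^ d) / d) ^ rk * (2 * Cb ^ (d * d) * M ^ d / M') *
              harmU K U ^ 3))) := by
  obtain ⟨CLS, hCLS, hLS⟩ := typeTwoLS (K := K)
  obtain ⟨Cg, hCg0, hCg⟩ := card_generators_box₀_le_fine (K := K)
  obtain ⟨CI, hCI, hCIle⟩ := card_idealsLE_le_linear K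
  have hd : 0 < d := Module.finrank_pos
  have hdR : (0 : ℝ) < d := by exact_mod_cast hd
  refine ⟨CLS * Real.sqrt (Cg * CI + 1), by positivity, ?_⟩
  intro k hk hks hk0 M hM U P hP Cb hCb M' hM' hM'M 𝔭₁ 𝔭₂ ρ₀ h𝔭₁ h𝔭₂ hρ hρpos hρbal Bl gen hBl hgen
  have hM0 : 0 < M := by linarith
  have hM'0 : 0 < M' := by linarith
  have hCb0 : 0 < Cb := by linarith
  have hN𝔭₁ := absNorm_pos_of_ne_bot h𝔭₁
  have hN𝔭₂ := absNorm_pos_of_ne_bot h𝔭₂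
  -- the cube sides
  obtain ⟨X₁, hX₁⟩ : ∃ X₁ : ℝ, X₁ = Cb * (Ideal.absNorm 𝔭₁ * M') ^ ((d : ℝ)⁻¹) := ⟨_, rfl⟩
  obtain ⟨X₂, hX₂⟩ : ∃ X₂ : ℝ, X₂ = Cb ^ d * (2 * Ideal.absNorm 𝔭₂ / M') ^ ((d : ℝ)⁻¹) * M := ⟨_, rfl⟩
  have hX₁pos : 0 < X₁ := by rw [hX₁]; positivity
  have hX₂pos : 0 < X₂ := by rw [hX₂]; positivity
  have hX₁d : X₁ ^ d = Cb ^ d * (Ideal.absNorm 𝔭₁ * M') := by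
    rw [hX₁, mul_pow, rpow_inv_pow (by positivity)]
  have hX₂d : X₂ ^ d = Cb ^ (d * d) * (2 * Ideal.absNorm 𝔭₂ / M') * M ^ d := by
    rw [hX₂, mul_pow, mul_pow, ← pow_mul, rpow_inv_pow (by positivity)]
  have hY₁ : X₁ ^ d / Ideal.absNorm 𝔭₁ = Cb ^ d * M' := by
    rw [hX₁d]; field_simp
  have hY₂ : X₂ ^ d / Ideal.absNorm 𝔭₂ = 2 * Cb ^ (d * d) * M ^ d / M' := by
    rw [hX₂d]; field_simp
  have hN₁ : (Ideal.absNorm 𝔭₁ : ℝ) ≤ X₁ ^ d := by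
    rw [hX₁d]
    have h1 : (1 : ℝ) ≤ Cb ^ d * M' := one_le_mul_of_one_le_of_one_le (one_le_pow₀ hCb) hM'
    nlinarith
  have hN₂ : (Ideal.absNorm 𝔭₂ : ℝ) ≤ X₂ ^ d := by
    rw [hX₂d]
    have h1 : (1 : ℝ) ≤ Cb ^ (d * d) := one_le_pow₀ hCb
    have h2 : (1 : ℝ) ≤ 2 * M ^ d / M' := by rw [le_div_iff₀ hM'0]; linarith
    have key : Cb ^ (d * d) * (2 * Ideal.absNorm 𝔭₂ / M') * M ^ d =
        Ideal.absNorm 𝔭₂ * (Cb ^ (d * d) * (2 * M ^ d / M')) := by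
      field_simp
    rw [key]
    have h12 : (1 : ℝ) ≤ Cb ^ (d * d) * (2 * M ^ d / M') := one_le_mul_of_one_le_of_one_le h1 h2
    nlinarith
  -- the finite sets
  obtain ⟨A₁, hA₁⟩ : ∃ A₁ : Finset (𝓞 K), A₁ = Bl.image gen := ⟨_, rfl⟩
  obtain ⟨A₂, hA₂⟩ : ∃ A₂ : Finset (𝓞 K), A₂ = (cubeF K X₂).filter (· ∈ 𝔭₂) := ⟨_, rfl⟩
  have hA₁mem : ∀ α ∈ A₁, α ∈ 𝔭₁ := by
    intro α hα
    rw [hA₁] at hα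
    obtain ⟨𝔟, h𝔟, rfl⟩ := Finset.mem_image.1 hα
    have : Ideal.span {gen 𝔟} ≤ 𝔭₁ := by rw [(hgen 𝔟 h𝔟).2.1]; exact Ideal.mul_le_right
    exact (Ideal.span_singleton_le_iff_mem _).1 this
  have hA₂mem : ∀ α ∈ A₂, α ∈ 𝔭₂ := fun α hα => by rw [hA₂] at hα; exact (Finset.mem_filter.1 hα).2
  have hbox₁ : ∀ α ∈ A₁, ∀ w : RP, |remb K (α : K) w - (0 : RP → ℝ) w| ≤ X₁ := by
    intro α hα w
    rw [hA₁] at hα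
    obtain ⟨𝔟, h𝔟, rfl⟩ := Finset.mem_image.1 hα
    obtain ⟨hgpos, hgspan, hgbal⟩ := hgen 𝔟 h𝔟
    rw [Pi.zero_apply, sub_zero, abs_of_pos (remb_pos_of_isTotPos hgpos w)]
    refine (hgbal w).trans ?_
    rw [hX₁, hgspan, map_mul, Nat.cast_mul]
    gcongr
    exact (hBl 𝔟 h𝔟).2.2
  have hbox₂ : ∀ α ∈ A₂, ∀ w : RP, |remb K (α : K) w - (0 : RP → ℝ) w| ≤ X₂ := by
    intro α hα w
    rw [hA₂] at hα
    have hc := (Finset.mem_filter.1 hα).1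
    obtain ⟨hpos, hle⟩ := (mem_box₀_iff_remb.1 (mem_cubeF.1 hc)) w
    rw [Pi.zero_apply, sub_zero, abs_of_pos hpos]; exact hle
  -- the large sieve with the cross weight
  have hLS' := hLS P hP 𝔭₁ 𝔭₂ h𝔭₁ h𝔭₂ A₁ A₂ hA₁mem hA₂mem 0 0 X₁ X₂ hX₁pos hX₂pos hN₁ hN₂ hbox₁ hbox₂
    (coeff₁ K 𝔭₁) (coeff₂ K 𝔭₂ U) (fun _ => k) (fun _ => hk) (fun _ => hks) (logv K) (logv K)
    (fun w => logv K ρ₀ w + Real.log M)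
  -- the left-hand side is the sum of `bTerm`s
  have hLHS : ∑ 𝔮 ∈ (idealsLE K P).filter (fun 𝔮 => IsCoprime 𝔮 𝔭₁ ∧ IsCoprime 𝔮 𝔭₂),
      (Ideal.absNorm 𝔮 : ℝ) / Nat.card ((𝓞 K ⧸ 𝔮)ˣ) * ∑ χ ∈ primChars K 𝔮, ‖S4block K χ k M U Bl (cubeF K M)‖ =
      ∑ 𝔮 ∈ (idealsLE K P).filter (fun 𝔮 => IsCoprime 𝔮 𝔭₁ ∧ IsCoprime 𝔮 𝔭₂),
        bTerm K 𝔮 A₁ A₂ (fun α₁ α₂ => coeff₁ K 𝔭₁ α₁ * coeff₂ K 𝔭₂ U α₂ *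
          crossWeight (fun _ : RP => k) (logv K) (logv K) (fun w => logv K ρ₀ w + Real.log M) α₁ α₂) := by
    refine Finset.sum_congr rfl fun 𝔮 h𝔮 => ?_
    rw [Finset.mem_filter, mem_idealsLE] at h𝔮
    obtain ⟨⟨h𝔮0, -⟩, hc₁, hc₂⟩ := h𝔮
    haveI : Finite (𝓞 K ⧸ 𝔮) := Ideal.finiteQuotientOfFreeOfNeBot 𝔮 h𝔮0
    letI : Fintype (𝓞 K ⧸ 𝔮) := Fintype.ofFinite _
    rw [bTerm_eq_sum_primChars h𝔮0]
    congr 1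
    refine Finset.sum_congr rfl fun χ _ => ?_
    have hcov : ∀ 𝔟 ∈ Bl, ∀ α ∈ cubeF K M, 𝔟 ∣ Ideal.span {α} → weightΩ K k M α ≠ 0 → quot ρ₀ (gen 𝔟) α ∈ A₂ := by
      intro 𝔟 h𝔟 α hα hdvd _
      obtain ⟨h𝔟0, hN𝔟, -⟩ := hBl 𝔟 h𝔟
      obtain ⟨hgpos, hgspan, hgbal⟩ := hgen 𝔟 h𝔟
      obtain ⟨hqpos, hqmem, hqle⟩ := quot_mem_A₂ h𝔭₁ h𝔭₂ h𝔟0 hρ hρpos hgspan hgpos hCb hρbal hgbal hM0 hM'0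
        hN𝔟 hα hdvd
      rw [hA₂, Finset.mem_filter, mem_cubeF, mem_box₀_iff_remb]
      exact ⟨fun w => ⟨remb_pos_of_isTotPos hqpos w, by rw [hX₂]; exact hqle w⟩, hqmem⟩
    rw [norm_S4block_eq χ k M U Bl gen (cubeF K M) A₂ hρ hρpos (isUnit_rho hρ hc₁ hc₂) h𝔭₁
      (fun 𝔟 h𝔟 => ⟨(hgen 𝔟 h𝔟).1, (hgen 𝔟 h𝔟).2.1⟩) (fun α hα => isTotPos_of_mem_cubeF hα)
      (fun α hα hne => mem_cubeF_of_weightΩ_ne_zero hk0 hM0 hα hne) hcov, hA₁]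
    congr 1
  rw [hLHS]
  refine hLS'.trans ?_
  -- the factor `∏_w ‖k̂‖₁ = ‖k̂‖₁^d`
  have hprod : ∏ _w : RP, ∫ τ, ‖𝓕 k τ‖ = (∫ τ, ‖𝓕 k τ‖) ^ d := by
    rw [Finset.prod_const, Finset.card_univ, SmoothCoset.card_RP_eq]
  rw [hprod, hY₁, hY₂]
  -- the coefficient bounds
  have hS₁ := sum_norm_coeff₁_sq_le h𝔭₁ Bl gen (fun 𝔟 h => (hgen 𝔟 h).2.1) (fun 𝔟 h => (hBl 𝔟 h).2.2)
    fun 𝔟 h => (hBl 𝔟 h).1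
  have hS₂ := sum_norm_coeff₂_sq_le hCg0 hCg hCI.le hCIle h𝔭₂ U hX₂pos hN₂
  rw [hY₂, ← hA₂] at hS₂
  rw [← hA₁] at hS₁
  -- replace `log(2C M^d/M')` by `log(2C M^d)`
  have hlogle : Real.log (2 * Cb ^ (d * d) * M ^ d / M') ≤ Real.log (2 * Cb ^ (d * d) * M ^ d) := by
    apply Real.log_le_log (by positivity)
    rw [div_le_iff₀ hM'0]
    have : 0 ≤ 2 * Cb ^ (d * d) * M ^ d := by positivity
    nlinarith
  have hlog0 : 0 ≤ 1 + Real.log (2 * Cb ^ (d * d) * M ^ d / M') / d := by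
    have h1 : 1 ≤ 2 * Cb ^ (d * d) * M ^ d / M' := by
      rw [le_div_iff₀ hM'0, one_mul]
      have : (1 : ℝ) ≤ Cb ^ (d * d) := one_le_pow₀ hCb
      nlinarith [pow_pos hM0 d]
    have : 0 ≤ Real.log (2 * Cb ^ (d * d) * M ^ d / M') := Real.log_nonneg h1
    exact add_nonneg zero_le_one (div_nonneg this hdR.le)
  have hS₂' : ∑ α₂ ∈ A₂, ‖coeff₂ K 𝔭₂ U α₂‖ ^ 2 ≤
      (Cg * CI + 1) * ((1 + Real.log (2 * Cb ^ (d * d) * M ^ d) / d) ^ rk * (2 * Cb ^ (d * d) * M ^ d / M') *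
        harmU K U ^ 3) := by
    refine hS₂.trans ?_
    obtain ⟨L', hL'⟩ : ∃ L' : ℝ, L' = (1 + Real.log (2 * Cb ^ (d * d) * M ^ d / M') / d) ^ rk := ⟨_, rfl⟩
    obtain ⟨L, hL⟩ : ∃ L : ℝ, L = (1 + Real.log (2 * Cb ^ (d * d) * M ^ d) / d) ^ rk := ⟨_, rfl⟩
    obtain ⟨Y, hYdef⟩ : ∃ Y : ℝ, Y = 2 * Cb ^ (d * d) * M ^ d / M' := ⟨_, rfl⟩
    obtain ⟨H3, hH3⟩ : ∃ H3 : ℝ, H3 = harmU K U ^ 3 := ⟨_, rfl⟩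
    have hfold : (∑ 𝔡 ∈ idealsLE K U, ((Ideal.absNorm 𝔡 : ℕ) : ℝ)⁻¹) ^ 3 = H3 := by rw [hH3]; rfl
    rw [hfold, ← hH3, ← hL', ← hL, ← hYdef]
    have hH : 0 ≤ H3 := by rw [hH3]; exact pow_nonneg (harmU_nonneg (K := K) U) 3
    have hY0 : 0 ≤ Y := by
      rw [hYdef]; exact div_nonneg (mul_nonneg (mul_nonneg zero_le_two (pow_nonneg hCb0.le _)) (pow_nonneg hM0.le _)) hM'0.le
    have hL'0 : 0 ≤ L' := by rw [hL']; exact pow_nonneg hlog0 _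
    have hL'L : L' ≤ L := by
      rw [hL', hL]
      exact pow_le_pow_left₀ hlog0 (by linarith [div_le_div_of_nonneg_right hlogle hdR.le]) _
    have hCI0 := hCI.le
    calc Cg * L' * (CI * Y * H3) = (Cg * CI) * (L' * (Y * H3)) := by ring
      _ ≤ (Cg * CI + 1) * (L * (Y * H3)) := by
          refine mul_le_mul (by linarith) (mul_le_mul_of_nonneg_right hL'L (mul_nonneg hY0 hH)) ?_ (by positivity)
          exact mul_nonneg hL'0 (mul_nonneg hY0 hH)
      _ = (Cg * CI + 1) * (L * Y * H3) := by ring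
  -- assemble: fold the big real expressions into atoms
  obtain ⟨E₁, hE₁⟩ : ∃ E₁ : ℝ, E₁ = P ^ 2 + Cb ^ d * M' := ⟨_, rfl⟩
  obtain ⟨E₂, hE₂⟩ : ∃ E₂ : ℝ, E₂ = P ^ 2 + 2 * Cb ^ (d * d) * M ^ d / M' := ⟨_, rfl⟩
  obtain ⟨W, hW⟩ : ∃ W : ℝ, W = (1 + Real.log (2 * Cb ^ (d * d) * M ^ d) / d) ^ rk *
    (2 * Cb ^ (d * d) * M ^ d / M') * harmU K U ^ 3 := ⟨_, rfl⟩
  obtain ⟨Kk, hKk⟩ : ∃ Kk : ℝ, Kk = (∫ τ, ‖𝓕 k τ‖) ^ d := ⟨_, rfl⟩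
  obtain ⟨S₁, hS₁def⟩ : ∃ S₁ : ℝ, S₁ = ∑ α ∈ A₁, ‖coeff₁ K 𝔭₁ α‖ ^ 2 := ⟨_, rfl⟩
  obtain ⟨S₂, hS₂def⟩ : ∃ S₂ : ℝ, S₂ = ∑ α ∈ A₂, ‖coeff₂ K 𝔭₂ U α‖ ^ 2 := ⟨_, rfl⟩
  obtain ⟨B₁, hB₁⟩ : ∃ B₁ : ℝ, B₁ = Real.log M' ^ 2 * Bl.card := ⟨_, rfl⟩
  rw [← hE₁, ← hE₂, ← hW, ← hKk, ← hS₁def, ← hS₂def, ← hB₁]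
  rw [← hS₁def, ← hB₁] at hS₁
  rw [← hS₂def, ← hW] at hS₂'
  have hE₁0 : 0 ≤ E₁ := by rw [hE₁]; positivity
  have hE₂0 : 0 ≤ E₂ := by rw [hE₂]; positivity
  have hW0 : 0 ≤ W := by
    rw [hW]
    have := harmU_nonneg (K := K) U
    have h2 : 0 ≤ 2 * Cb ^ (d * d) * M ^ d / M' := by positivity
    have h3 : 0 ≤ 1 + Real.log (2 * Cb ^ (d * d) * M ^ d) / d := by
      refine hlog0.trans ?_
      gcongr
    positivity
  have hKk0 : 0 ≤ Kk := by rw [hKk]; exact pow_nonneg (integral_nonneg fun _ => norm_nonneg _) _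
  have hS₂0 : 0 ≤ S₂ := by rw [hS₂def]; positivity
  have hsq₁ : Real.sqrt (E₁ * S₁) ≤ Real.sqrt (E₁ * B₁) := Real.sqrt_le_sqrt (mul_le_mul_of_nonneg_left hS₁ hE₁0)
  have hsq₂ : Real.sqrt (E₂ * S₂) ≤ Real.sqrt (Cg * CI + 1) * Real.sqrt (E₂ * W) := by
    rw [← Real.sqrt_mul (by positivity)]
    refine Real.sqrt_le_sqrt ?_
    calc E₂ * S₂ ≤ E₂ * ((Cg * CI + 1) * W) := mul_le_mul_of_nonneg_left hS₂' hE₂0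
      _ = (Cg * CI + 1) * (E₂ * W) := by ring
  calc CLS * Kk * (Real.sqrt (E₁ * S₁) * Real.sqrt (E₂ * S₂))
      ≤ CLS * Kk * (Real.sqrt (E₁ * B₁) * (Real.sqrt (Cg * CI + 1) * Real.sqrt (E₂ * W))) := by
        gcongr
    _ = CLS * Real.sqrt (Cg * CI + 1) * Kk * (Real.sqrt (E₁ * B₁) * Real.sqrt (E₂ * W)) := by ring

end Literature.NumberTheory.Sieve.TypeTwoBlock
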